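import Summits.ResolutionOfSingularities.ResolutionOfSingularities.Theorems.CofactorCutKernels2
import HarnessLib

/-! # CofactorCutCells — decomp-res-lens-4 g39 «CofactorCut», FILE C (§127 the cofactor cut C₃♮ʳᶠ♯ = C₃♮ʳᶠ♯ᵏ♭ ∧ C₃♮ʳᶠ♯ᵏ♯, the kill of
C₃♮ʳᶠ♯ᵏ♭ in minimal currency, the re-locations and the g39 located residual `NoWildOccultCofactorBirthRecurrentCurveFreeCompanionNonLineMixedTowers`). -/

set_option linter.dupNamespace false
set_option linter.unusedSectionVars false

noncomputable section

open CategoryTheory AlgebraicGeometry IsLocalRing TopologicalSpace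
open Literature.AlgebraicGeometry.Resolution
open Summit.ResolutionOfSingularities.ResolutionOfSingularities.Theorems
open WeakOrderReduction ForcedTowerClasses DivergentTowerClasses MonomialTowerClasses
open HugDimensionClasses HugDimensionKernels SurfaceShadowClasses SurfaceShadowKernels
open NearPointCut (SingularClass)
open Scheme.IdealSheafData (vanishingIdeal)

universe u

namespace Summit.ResolutionOfSingularities.ResolutionOfSingularities.Theorems.HugValuationCut

/-! ## ══ FILE C `Theorems/CofactorCutCells.lean` (§127; cone-free; imports FILE B) ══ -/

section CofactorCells

/-! ## §127 (g39 · NEW) THE COFACTOR CUT of the g38 residual core C₃♮ʳᶠ♯ by the new letter (KFB): C₃♮ʳᶠ♯ = C₃♮ʳᶠ♯ᵏ♭ ∧ C₃♮ʳᶠ♯ᵏ♯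

ONE exact em-cut of CELL C₃♮ʳᶠ♯ (`WildOccultDivisorialThreefoldNonLineRecurrentCompanionCurveFreeBirthRecurrentMixedWallFreeFreshJumpShallowCompanionKangarooTowersTerminate n`) by the NEW letter (KFB)
`BirthFreeCofactorTower` (`noTowerWild_split`).  THE (KFB)-HALF C₃♮ʳᶠ♯ᵏ♭ IS EMPTY IN THE TREE'S MINIMAL-WEIGHT CURRENCY
`MinimalAt n` (= the `hlow` binder of g16's «WeightDescent» `forcedTowersTerminate_of_g16` / `ftt_step_of_g16`, CITED, not
re-introduced) — PORT-FREE, every `p`, every field, every weight —, by its two branches: «c = 0» C₃♮ʳᶠ♯ⁱ (an isolated cofactor,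
(KI∞)) dies by the DESCENT LAW §125 (g36's `companionTower` re-rooting at the cofactor of weight `b < n` + `MinimalAt n`), «c ≥ 1»
C₃♮ʳᶠ♯ᵒ♭ (no isolated cofactor but a birth-free one) dies HYPOTHESIS-FREE by the COFACTOR LAW §126 (the NON-PRINCIPAL FACTOR LAW
(L1′) + g38's transport / count / recursion BY NAME for `G := K` ⟹ (KI∞) ∨ (CF∞), both excluded by the letters).  THE LOCATED
RESIDUAL CORE after g39 = C₃♮ʳᶠ♯ᵏ♯ «COFACTOR-BIRTH-RECURRENT»: BOTH factors of every principal companion datum are birth-recurrent —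
and (Law D, §124) never co-born.  §128 (FILE D) re-roots the minimal-currency decision into the tree's root consumer
`ftt_step_of_g22` / 30253 `MaxContactCut.NoForcedTowers` with EXACTLY g22's side hypotheses. -/

variable {k : Type} [Field k]

/-- **CELL C₃♮ʳᶠ♯ᵏ♭ (the g38 residual core WITH A BIRTH-FREE COFACTOR: some principal companion of weight `≥ 2` at some stage has a
cofactor of positive weight whose chain of controlled transforms is birth-free)** — DECIDED: EMPTY IN MINIMAL CURRENCY
(`…CofactorBirthFreeMixed_of_minimal` / `_of_lower`; port-free). -/
def WildOccultDivisorialThreefoldNonLineRecurrentCompanionCurveFreeBirthRecurrentCofactorBirthFreeMixedWallFreeFreshJumpShallowCompanionKangarooTowersTerminate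
    (n : ℕ) : Prop :=
  NoTowerWild n fun T => ((((((((MixedResidual n T ∧ ¬ (LatentFactorTower T ∧ ThreefoldTower T)) ∧ ¬ LatentFactorTower T) ∧
    DivisorialTower T) ∧ ThreefoldTower T) ∧ ¬ FollowsLineTower T) ∧ ¬ IsolatedCompanionTower T) ∧ ¬ FollowsCurveTower T) ∧
    ¬ BirthFreeCompanionTower T) ∧
    BirthFreeCofactorTower T

/-- **CELL C₃♮ʳᶠ♯ᵏ♯ · THE LOCATED RESIDUAL CORE after g39 — «THE COFACTOR-BIRTH-RECURRENT CURVE-FREE OCCULT THREEFOLD TOWER»**: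
wild, occult, divisorial, ring dimension 3, following no line and no curve germ, every principal companion of weight `≥ 2`
birth-recurrent and recurrently non-isolated (g36/g38 letters), AND THE COFACTOR (positive weight) OF EVERY SUCH COMPANION
BIRTH-RECURRENT TOO (¬(KFB)): by LAW D the companion chain and the cofactor chain are never born at a common point and each birth of
either is PINNED by the other (`doublyRecurrent_frequently_coBornAt`).  UNDECIDED · IDEA-NEEDED (no law on record; no certified
inhabitant; honest placement in the NODE header). -/
def WildOccultDivisorialThreefoldNonLineRecurrentCompanionCurveFreeBirthRecurrentCofactorBirthRecurrentMixedWallFreeFreshJumpShallowCompanionKangarooTowersTerminate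
    (n : ℕ) : Prop :=
  NoTowerWild n fun T => ((((((((MixedResidual n T ∧ ¬ (LatentFactorTower T ∧ ThreefoldTower T)) ∧ ¬ LatentFactorTower T) ∧
    DivisorialTower T) ∧ ThreefoldTower T) ∧ ¬ FollowsLineTower T) ∧ ¬ IsolatedCompanionTower T) ∧ ¬ FollowsCurveTower T) ∧
    ¬ BirthFreeCompanionTower T) ∧
    ¬ BirthFreeCofactorTower T

/-- **SUB-CELL C₃♮ʳᶠ♯ⁱ = the «c = 0» branch of the kill (the g38 core WITH AN ISOLATED COFACTOR, (KI∞))** — EMPTY IN MINIMAL CURRENCY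
by the descent law alone (g16's induction ∘ g36's tool; banked, no new law). -/
def WildOccultDivisorialThreefoldNonLineRecurrentCompanionCurveFreeBirthRecurrentIsolatedCofactorMixedWallFreeFreshJumpShallowCompanionKangarooTowersTerminate
    (n : ℕ) : Prop :=
  NoTowerWild n fun T => ((((((((MixedResidual n T ∧ ¬ (LatentFactorTower T ∧ ThreefoldTower T)) ∧ ¬ LatentFactorTower T) ∧
    DivisorialTower T) ∧ ThreefoldTower T) ∧ ¬ FollowsLineTower T) ∧ ¬ IsolatedCompanionTower T) ∧ ¬ FollowsCurveTower T) ∧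
    ¬ BirthFreeCompanionTower T) ∧
    IsolatedCofactorTower T

/-- **SUB-CELL C₃♮ʳᶠ♯ᵒ♭ = the «c ≥ 1» branch of the kill (the g38 core WITH NO ISOLATED COFACTOR BUT A BIRTH-FREE ONE)** — EMPTY
HYPOTHESIS-FREE, PORT-FREE by the cofactor law (the new non-principal factor law is load-bearing here). -/
def WildOccultDivisorialThreefoldNonLineRecurrentCompanionCurveFreeBirthRecurrentNonIsolatedCofactorCofactorBirthFreeMixedWallFreeFreshJumpShallowCompanionKangarooTowersTerminate
    (n : ℕ) : Prop :=
  NoTowerWild n fun T => (((((((((MixedResidual n T ∧ ¬ (LatentFactorTower T ∧ ThreefoldTower T)) ∧ ¬ LatentFactorTower T) ∧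
    DivisorialTower T) ∧ ThreefoldTower T) ∧ ¬ FollowsLineTower T) ∧ ¬ IsolatedCompanionTower T) ∧ ¬ FollowsCurveTower T) ∧
    ¬ BirthFreeCompanionTower T) ∧
    ¬ IsolatedCofactorTower T) ∧ BirthFreeCofactorTower T

/-- **EXACT (pure logic): C₃♮ʳᶠ♯ = C₃♮ʳᶠ♯ᵏ♭ ∧ C₃♮ʳᶠ♯ᵏ♯** — the cofactor cut. [folklore] -/
theorem wildOccultDivisorialThreefoldNonLineRecurrentCompanionCurveFreeBirthRecurrentMixed_split_cofactorBirth (n : ℕ) :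
    WildOccultDivisorialThreefoldNonLineRecurrentCompanionCurveFreeBirthRecurrentMixedWallFreeFreshJumpShallowCompanionKangarooTowersTerminate n ↔
      WildOccultDivisorialThreefoldNonLineRecurrentCompanionCurveFreeBirthRecurrentCofactorBirthFreeMixedWallFreeFreshJumpShallowCompanionKangarooTowersTerminate
          n ∧
        WildOccultDivisorialThreefoldNonLineRecurrentCompanionCurveFreeBirthRecurrentCofactorBirthRecurrentMixedWallFreeFreshJumpShallowCompanionKangarooTowersTerminate
          n :=
  noTowerWild_split _ BirthFreeCofactorTower

/-- **SUB-CELL C₃♮ʳᶠ♯ᵒ♭ IS EMPTY — HYPOTHESIS-FREE, PORT-FREE (every `n`; the cofactor law).** [folklore] -/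
theorem wildOccultDivisorialThreefoldNonLineRecurrentCompanionCurveFreeBirthRecurrentNonIsolatedCofactorCofactorBirthFreeMixed_holds (n : ℕ) :
    WildOccultDivisorialThreefoldNonLineRecurrentCompanionCurveFreeBirthRecurrentNonIsolatedCofactorCofactorBirthFreeMixedWallFreeFreshJumpShallowCompanionKangarooTowersTerminate
      n :=
  noTowerWild_mono (fun _ h => ⟨⟨⟨⟨⟨h.1.1, h.1.1.1.1.1.1.1.1.2⟩, h.1.1.1.1.1.1.2⟩, h.1.2⟩, h.1.1.1.2⟩, h.2⟩)
    (noTowerWild_occult_threefold_birthFreeCofactor n fun T =>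
      (((((((MixedResidual n T ∧ ¬ (LatentFactorTower T ∧ ThreefoldTower T)) ∧ ¬ LatentFactorTower T) ∧
    DivisorialTower T) ∧ ThreefoldTower T) ∧ ¬ FollowsLineTower T) ∧ ¬ IsolatedCompanionTower T) ∧ ¬ FollowsCurveTower T) ∧
    ¬ BirthFreeCompanionTower T)

/-- **SUB-CELL C₃♮ʳᶠ♯ⁱ IS EMPTY IN MINIMAL CURRENCY (every `n`; the descent law; the tree's `hlow` binder verbatim).** [folklore] -/
theorem wildOccultDivisorialThreefoldNonLineRecurrentCompanionCurveFreeBirthRecurrentIsolatedCofactorMixed_of_lower (n : ℕ)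
    (hlow : ∀ n' : ℕ, 1 ≤ n' → n' < n → ForcedTowersTerminate n') :
    WildOccultDivisorialThreefoldNonLineRecurrentCompanionCurveFreeBirthRecurrentIsolatedCofactorMixedWallFreeFreshJumpShallowCompanionKangarooTowersTerminate
      n :=
  noTowerWild_isolatedCofactor_of_minimal n _ hlow

/-- the same, with the named currency `MinimalAt n` (definitionally the `hlow` binder). [folklore] -/
theorem wildOccultDivisorialThreefoldNonLineRecurrentCompanionCurveFreeBirthRecurrentIsolatedCofactorMixed_of_minimal (n : ℕ) (hmin : MinimalAt n) :
    WildOccultDivisorialThreefoldNonLineRecurrentCompanionCurveFreeBirthRecurrentIsolatedCofactorMixedWallFreeFreshJumpShallowCompanionKangarooTowersTerminate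
      n :=
  wildOccultDivisorialThreefoldNonLineRecurrentCompanionCurveFreeBirthRecurrentIsolatedCofactorMixed_of_lower n hmin

/-- **THE KILL — CELL C₃♮ʳᶠ♯ᵏ♭ IS EMPTY IN MINIMAL CURRENCY (every `p`, field, weight; port-free; hypothesis-free but for
`MinimalAt n`)**: cut the cell by (KI∞) (`noTowerWild_split`); the (KI∞)-branch is C₃♮ʳᶠ♯ⁱ (descent law + `MinimalAt n`), the
¬(KI∞)-branch is C₃♮ʳᶠ♯ᵒ♭ (cofactor law, hypothesis-free). [folklore] -/
theorem wildOccultDivisorialThreefoldNonLineRecurrentCompanionCurveFreeBirthRecurrentCofactorBirthFreeMixed_of_minimal (n : ℕ) (hmin : MinimalAt n) :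
    WildOccultDivisorialThreefoldNonLineRecurrentCompanionCurveFreeBirthRecurrentCofactorBirthFreeMixedWallFreeFreshJumpShallowCompanionKangarooTowersTerminate
      n :=
  (noTowerWild_split _ IsolatedCofactorTower).mpr
    ⟨noTowerWild_isolatedCofactor_of_minimal n _ hmin,
      noTowerWild_mono (fun _ h => ⟨⟨h.1.1, h.2⟩, h.1.2⟩)
        (wildOccultDivisorialThreefoldNonLineRecurrentCompanionCurveFreeBirthRecurrentNonIsolatedCofactorCofactorBirthFreeMixed_holds n)⟩

/-- the same with the tree's `hlow` binder. [folklore] -/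
theorem wildOccultDivisorialThreefoldNonLineRecurrentCompanionCurveFreeBirthRecurrentCofactorBirthFreeMixed_of_lower (n : ℕ)
    (hlow : ∀ n' : ℕ, 1 ≤ n' → n' < n → ForcedTowersTerminate n') :
    WildOccultDivisorialThreefoldNonLineRecurrentCompanionCurveFreeBirthRecurrentCofactorBirthFreeMixedWallFreeFreshJumpShallowCompanionKangarooTowersTerminate
      n :=
  wildOccultDivisorialThreefoldNonLineRecurrentCompanionCurveFreeBirthRecurrentCofactorBirthFreeMixed_of_minimal n hlow

/-- **EXACT RE-LOCATION OF THE g38 CORE IN MINIMAL CURRENCY: C₃♮ʳᶠ♯ ⟺ C₃♮ʳᶠ♯ᵏ♯.** [folklore] -/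
theorem wildOccultDivisorialThreefoldNonLineRecurrentCompanionCurveFreeBirthRecurrentMixed_iff_g39_of_minimal (n : ℕ) (hmin : MinimalAt n) :
    WildOccultDivisorialThreefoldNonLineRecurrentCompanionCurveFreeBirthRecurrentMixedWallFreeFreshJumpShallowCompanionKangarooTowersTerminate n ↔
      WildOccultDivisorialThreefoldNonLineRecurrentCompanionCurveFreeBirthRecurrentCofactorBirthRecurrentMixedWallFreeFreshJumpShallowCompanionKangarooTowersTerminate
        n :=
  (wildOccultDivisorialThreefoldNonLineRecurrentCompanionCurveFreeBirthRecurrentMixed_split_cofactorBirth n).trans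
    ⟨fun h => h.2, fun h => ⟨wildOccultDivisorialThreefoldNonLineRecurrentCompanionCurveFreeBirthRecurrentCofactorBirthFreeMixed_of_minimal n hmin, h⟩⟩

/-- the same with the tree's `hlow` binder. [folklore] -/
theorem wildOccultDivisorialThreefoldNonLineRecurrentCompanionCurveFreeBirthRecurrentMixed_iff_g39_of_lower (n : ℕ)
    (hlow : ∀ n' : ℕ, 1 ≤ n' → n' < n → ForcedTowersTerminate n') :
    WildOccultDivisorialThreefoldNonLineRecurrentCompanionCurveFreeBirthRecurrentMixedWallFreeFreshJumpShallowCompanionKangarooTowersTerminate n ↔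
      WildOccultDivisorialThreefoldNonLineRecurrentCompanionCurveFreeBirthRecurrentCofactorBirthRecurrentMixedWallFreeFreshJumpShallowCompanionKangarooTowersTerminate
        n :=
  wildOccultDivisorialThreefoldNonLineRecurrentCompanionCurveFreeBirthRecurrentMixed_iff_g39_of_minimal n hlow

/-- down-link, HYPOTHESIS-FREE: C₃♮ʳᶠ♯ ⟹ C₃♮ʳᶠ♯ᵏ♯. [folklore] -/
theorem wildOccultDivisorialThreefoldNonLineRecurrentCompanionCurveFreeBirthRecurrentCofactorBirthRecurrentMixed_of_g38 {n : ℕ}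
    (h : WildOccultDivisorialThreefoldNonLineRecurrentCompanionCurveFreeBirthRecurrentMixedWallFreeFreshJumpShallowCompanionKangarooTowersTerminate n) :
    WildOccultDivisorialThreefoldNonLineRecurrentCompanionCurveFreeBirthRecurrentCofactorBirthRecurrentMixedWallFreeFreshJumpShallowCompanionKangarooTowersTerminate
      n :=
  ((wildOccultDivisorialThreefoldNonLineRecurrentCompanionCurveFreeBirthRecurrentMixed_split_cofactorBirth n).mp h).2

/-- **EXACT RE-LOCATION OF CELL C₃♮ʳ IN MINIMAL CURRENCY: C₃♮ʳ ⟺ C₃♮ʳᶠ♯ᵏ♯** (g37/g38 hypothesis-free links + g39). [folklore] -/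
theorem wildOccultDivisorialThreefoldNonLineRecurrentCompanionMixed_iff_g39_of_lower (n : ℕ)
    (hlow : ∀ n' : ℕ, 1 ≤ n' → n' < n → ForcedTowersTerminate n') :
    WildOccultDivisorialThreefoldNonLineRecurrentCompanionMixedWallFreeFreshJumpShallowCompanionKangarooTowersTerminate n ↔
      WildOccultDivisorialThreefoldNonLineRecurrentCompanionCurveFreeBirthRecurrentCofactorBirthRecurrentMixedWallFreeFreshJumpShallowCompanionKangarooTowersTerminate
        n :=
  (wildOccultDivisorialThreefoldNonLineRecurrentCompanionMixed_iff_g38 n).trans (wildOccultDivisorialThreefoldNonLineRecurrentCompanionCurveFreeBirthRecurrentMixed_iff_g39_of_lower n hlow)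

/-- **EXACT RE-LOCATION OF CELL C₃ MODULO THE PORT, IN MINIMAL CURRENCY: C₃ ⟺ C₃♮ʳᶠ♯ᵏ♯.** [folklore] -/
theorem wildOccultDivisorialThreefoldMixed_iff_g39_of_port_of_lower (h640 : SurfaceChainPort) (n : ℕ)
    (hlow : ∀ n' : ℕ, 1 ≤ n' → n' < n → ForcedTowersTerminate n') :
    WildOccultDivisorialThreefoldMixedWallFreeFreshJumpShallowCompanionKangarooTowersTerminate n ↔
      WildOccultDivisorialThreefoldNonLineRecurrentCompanionCurveFreeBirthRecurrentCofactorBirthRecurrentMixedWallFreeFreshJumpShallowCompanionKangarooTowersTerminate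
        n :=
  (wildOccultDivisorialThreefoldMixed_iff_g38_of_port h640 n).trans (wildOccultDivisorialThreefoldNonLineRecurrentCompanionCurveFreeBirthRecurrentMixed_iff_g39_of_lower n hlow)

/-- **EXACT RE-LOCATION OF CELL C MODULO THE PORT, IN MINIMAL CURRENCY: C ⟺ C₃♮ʳᶠ♯ᵏ♯ ∧ C₄.** [folklore] -/
theorem wildOccultDivisorialMixed_iff_g39_of_port_of_lower (h640 : SurfaceChainPort) (n : ℕ)
    (hlow : ∀ n' : ℕ, 1 ≤ n' → n' < n → ForcedTowersTerminate n') :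
    WildOccultDivisorialMixedWallFreeFreshJumpShallowCompanionKangarooTowersTerminate n ↔
      WildOccultDivisorialThreefoldNonLineRecurrentCompanionCurveFreeBirthRecurrentCofactorBirthRecurrentMixedWallFreeFreshJumpShallowCompanionKangarooTowersTerminate
          n ∧
        WildOccultDivisorialNonThreefoldMixedWallFreeFreshJumpShallowCompanionKangarooTowersTerminate n :=
  (wildOccultDivisorialMixed_iff_g38_of_port h640 n).trans (Iff.and (wildOccultDivisorialThreefoldNonLineRecurrentCompanionCurveFreeBirthRecurrentMixed_iff_g39_of_lower n hlow) Iff.rfl)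

/-- BY NAME: **no wild g38-core tower WITH A BIRTH-FREE COFACTOR** (CELL C₃♮ʳᶠ♯ᵏ♭; DECIDED IN MINIMAL CURRENCY weight by weight:
`…CofactorBirthFreeMixedTowers_of_minimal`). -/
def NoWildOccultDivisorialThreefoldNonLineRecurrentCompanionCurveFreeBirthRecurrentCofactorBirthFreeMixedTowers : Prop :=
  ∀ n : ℕ, 1 ≤ n →
    WildOccultDivisorialThreefoldNonLineRecurrentCompanionCurveFreeBirthRecurrentCofactorBirthFreeMixedWallFreeFreshJumpShallowCompanionKangarooTowersTerminate
      n

/-- BY NAME: **no wild COFACTOR-BIRTH-RECURRENT curve-free occult divisorial threefold tower** (CELL C₃♮ʳᶠ♯ᵏ♯; UNDECIDED — the located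
residual core after g39). -/
def NoWildOccultDivisorialThreefoldNonLineRecurrentCompanionCurveFreeBirthRecurrentCofactorBirthRecurrentMixedTowers : Prop :=
  ∀ n : ℕ, 1 ≤ n →
    WildOccultDivisorialThreefoldNonLineRecurrentCompanionCurveFreeBirthRecurrentCofactorBirthRecurrentMixedWallFreeFreshJumpShallowCompanionKangarooTowersTerminate
      n

/-- BY NAME: sub-cell C₃♮ʳᶠ♯ⁱ over all weights (decided in minimal currency weight by weight). -/
def NoWildOccultDivisorialThreefoldNonLineRecurrentCompanionCurveFreeBirthRecurrentIsolatedCofactorMixedTowers : Prop :=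
  ∀ n : ℕ, 1 ≤ n →
    WildOccultDivisorialThreefoldNonLineRecurrentCompanionCurveFreeBirthRecurrentIsolatedCofactorMixedWallFreeFreshJumpShallowCompanionKangarooTowersTerminate
      n

/-- BY NAME: sub-cell C₃♮ʳᶠ♯ᵒ♭ over all weights (DECIDED, HYPOTHESIS-FREE). -/
def NoWildOccultDivisorialThreefoldNonLineRecurrentCompanionCurveFreeBirthRecurrentNonIsolatedCofactorCofactorBirthFreeMixedTowers : Prop :=
  ∀ n : ℕ, 1 ≤ n →
    WildOccultDivisorialThreefoldNonLineRecurrentCompanionCurveFreeBirthRecurrentNonIsolatedCofactorCofactorBirthFreeMixedWallFreeFreshJumpShallowCompanionKangarooTowersTerminate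
      n

/-- BY NAME: **THE LOCATED RESIDUAL of the lens-4 NP column after g39 — «no wild occult mixed tower that (is a cofactor-birth-recurrent
curve-free ruled-recurrent divisorial threefold following no line) or is not a threefold»** = (C₃♮ʳᶠ♯ᵏ♯ ∧ C₄) ∧ D₄. -/
def NoWildOccultCofactorBirthRecurrentCurveFreeCompanionNonLineMixedTowers : Prop :=
  (NoWildOccultDivisorialThreefoldNonLineRecurrentCompanionCurveFreeBirthRecurrentCofactorBirthRecurrentMixedTowers ∧
      NoWildOccultDivisorialNonThreefoldMixedTowers) ∧
    NoWildOccultNonDivisorialNonThreefoldMixedTowers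

/-- **SUB-CELL C₃♮ʳᶠ♯ᵒ♭ DECIDED BY NAME — HYPOTHESIS-FREE, PORT-FREE.** [folklore] -/
theorem noWildOccultDivisorialThreefoldNonLineRecurrentCompanionCurveFreeBirthRecurrentNonIsolatedCofactorCofactorBirthFreeMixedTowers_holds :
    NoWildOccultDivisorialThreefoldNonLineRecurrentCompanionCurveFreeBirthRecurrentNonIsolatedCofactorCofactorBirthFreeMixedTowers := fun n _ =>
  wildOccultDivisorialThreefoldNonLineRecurrentCompanionCurveFreeBirthRecurrentNonIsolatedCofactorCofactorBirthFreeMixed_holds n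

/-- **CELL C₃♮ʳᶠ♯ᵏ♭ DECIDED BY NAME IN MINIMAL CURRENCY, weight by weight.** [folklore] -/
theorem noWildOccultDivisorialThreefoldNonLineRecurrentCompanionCurveFreeBirthRecurrentCofactorBirthFreeMixedTowers_of_minimal :
    ∀ n : ℕ, 1 ≤ n → MinimalAt n →
      WildOccultDivisorialThreefoldNonLineRecurrentCompanionCurveFreeBirthRecurrentCofactorBirthFreeMixedWallFreeFreshJumpShallowCompanionKangarooTowersTerminate
        n := fun n _ hmin =>
  wildOccultDivisorialThreefoldNonLineRecurrentCompanionCurveFreeBirthRecurrentCofactorBirthFreeMixed_of_minimal n hmin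

/-- **EXACT RE-LOCATION BY NAME, HYPOTHESIS-FREE (pure logic): CELL C₃♮ʳᶠ♯ ⟺ CELL C₃♮ʳᶠ♯ᵏ♭ ∧ CELL C₃♮ʳᶠ♯ᵏ♯.** [folklore] -/
theorem noWildOccultDivisorialThreefoldNonLineRecurrentCompanionCurveFreeBirthRecurrentMixedTowers_iff_g39 :
    NoWildOccultDivisorialThreefoldNonLineRecurrentCompanionCurveFreeBirthRecurrentMixedTowers ↔
      NoWildOccultDivisorialThreefoldNonLineRecurrentCompanionCurveFreeBirthRecurrentCofactorBirthFreeMixedTowers ∧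
        NoWildOccultDivisorialThreefoldNonLineRecurrentCompanionCurveFreeBirthRecurrentCofactorBirthRecurrentMixedTowers :=
  ⟨fun h => ⟨fun n hn => ((wildOccultDivisorialThreefoldNonLineRecurrentCompanionCurveFreeBirthRecurrentMixed_split_cofactorBirth n).mp (h n hn)).1, fun n hn => ((wildOccultDivisorialThreefoldNonLineRecurrentCompanionCurveFreeBirthRecurrentMixed_split_cofactorBirth n).mp (h n hn)).2⟩,
    fun h n hn => (wildOccultDivisorialThreefoldNonLineRecurrentCompanionCurveFreeBirthRecurrentMixed_split_cofactorBirth n).mpr ⟨h.1 n hn, h.2 n hn⟩⟩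

/-- **EXACT RE-LOCATION BY NAME, HYPOTHESIS-FREE: the g38 located residual ⟺ CELL C₃♮ʳᶠ♯ᵏ♭ ∧ the g39 located residual.** [folklore] -/
theorem noWildOccultBirthRecurrentCurveFreeCompanionNonLineMixedTowers_iff_g39 :
    NoWildOccultBirthRecurrentCurveFreeCompanionNonLineMixedTowers ↔
      NoWildOccultDivisorialThreefoldNonLineRecurrentCompanionCurveFreeBirthRecurrentCofactorBirthFreeMixedTowers ∧ NoWildOccultCofactorBirthRecurrentCurveFreeCompanionNonLineMixedTowers := by
  unfold NoWildOccultBirthRecurrentCurveFreeCompanionNonLineMixedTowers NoWildOccultCofactorBirthRecurrentCurveFreeCompanionNonLineMixedTowers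
  rw [noWildOccultDivisorialThreefoldNonLineRecurrentCompanionCurveFreeBirthRecurrentMixedTowers_iff_g39]
  constructor
  · rintro ⟨⟨⟨hF, hR⟩, hC⟩, hD⟩
    exact ⟨hF, ⟨hR, hC⟩, hD⟩
  · rintro ⟨hF, ⟨hR, hC⟩, hD⟩
    exact ⟨⟨⟨hF, hR⟩, hC⟩, hD⟩

/-- down-link (HYPOTHESIS-FREE): the g39 located residual ⟸ the g38 located residual. [folklore] -/
theorem noWildOccultCofactorBirthRecurrentCurveFreeCompanionNonLineMixedTowers_of_g38
    (h : NoWildOccultBirthRecurrentCurveFreeCompanionNonLineMixedTowers) : NoWildOccultCofactorBirthRecurrentCurveFreeCompanionNonLineMixedTowers :=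
  (noWildOccultBirthRecurrentCurveFreeCompanionNonLineMixedTowers_iff_g39.mp h).2

/-- down-link (HYPOTHESIS-FREE): the g39 located residual ⟸ the g37 located residual. [folklore] -/
theorem noWildOccultCofactorBirthRecurrentCurveFreeCompanionNonLineMixedTowers_of_g37
    (h : NoWildOccultCurveFreeRecurrentCompanionNonLineMixedTowers) : NoWildOccultCofactorBirthRecurrentCurveFreeCompanionNonLineMixedTowers :=
  noWildOccultCofactorBirthRecurrentCurveFreeCompanionNonLineMixedTowers_of_g38 (noWildOccultBirthRecurrentCurveFreeCompanionNonLineMixedTowers_of_g37 h)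

/-- down-link (HYPOTHESIS-FREE): the g39 located residual ⟸ the g36 located residual. [folklore] -/
theorem noWildOccultCofactorBirthRecurrentCurveFreeCompanionNonLineMixedTowers_of_g36
    (h : NoWildOccultRecurrentCompanionNonLineMixedTowers) : NoWildOccultCofactorBirthRecurrentCurveFreeCompanionNonLineMixedTowers :=
  noWildOccultCofactorBirthRecurrentCurveFreeCompanionNonLineMixedTowers_of_g38 (noWildOccultBirthRecurrentCurveFreeCompanionNonLineMixedTowers_of_g36 h)

/-- down-link (HYPOTHESIS-FREE): the g39 located residual ⟸ the g35 located residual. [folklore] -/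
theorem noWildOccultCofactorBirthRecurrentCurveFreeCompanionNonLineMixedTowers_of_g35 (h : NoWildOccultNonLineMixedTowers) :
    NoWildOccultCofactorBirthRecurrentCurveFreeCompanionNonLineMixedTowers :=
  noWildOccultCofactorBirthRecurrentCurveFreeCompanionNonLineMixedTowers_of_g38 (noWildOccultBirthRecurrentCurveFreeCompanionNonLineMixedTowers_of_g35 h)

/-- down-link (HYPOTHESIS-FREE): the g39 located residual ⟸ the g34 located residual. [folklore] -/
theorem noWildOccultCofactorBirthRecurrentCurveFreeCompanionNonLineMixedTowers_of_g34
    (h : NoWildOccultDivisorialOrNonThreefoldMixedTowers) : NoWildOccultCofactorBirthRecurrentCurveFreeCompanionNonLineMixedTowers :=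
  noWildOccultCofactorBirthRecurrentCurveFreeCompanionNonLineMixedTowers_of_g38 (noWildOccultBirthRecurrentCurveFreeCompanionNonLineMixedTowers_of_g34 h)

/-- down-link (HYPOTHESIS-FREE): the g39 located residual ⟸ the g32 residual. [folklore] -/
theorem noWildOccultCofactorBirthRecurrentCurveFreeCompanionNonLineMixedTowers_of_g32
    (h : NoWildMixedWallFreeFreshJumpShallowCompanionKangarooTowers) : NoWildOccultCofactorBirthRecurrentCurveFreeCompanionNonLineMixedTowers :=
  noWildOccultCofactorBirthRecurrentCurveFreeCompanionNonLineMixedTowers_of_g38 (noWildOccultBirthRecurrentCurveFreeCompanionNonLineMixedTowers_of_g32 h)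

/-- down-link from the TREE aside `NoWildContactFreeOffLocusTowers` (HYPOTHESIS-FREE). [folklore] -/
theorem noWildOccultCofactorBirthRecurrentCurveFreeCompanionNonLineMixedTowers_of_aside (h : NoWildContactFreeOffLocusTowers) :
    NoWildOccultCofactorBirthRecurrentCurveFreeCompanionNonLineMixedTowers :=
  noWildOccultCofactorBirthRecurrentCurveFreeCompanionNonLineMixedTowers_of_g38 (noWildOccultBirthRecurrentCurveFreeCompanionNonLineMixedTowers_of_aside h)

/-- up-link (HYPOTHESIS-FREE): the g38 located residual ⟸ CELL C₃♮ʳᶠ♯ᵏ♭ ∧ the g39 located residual. [folklore] -/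
theorem noWildOccultBirthRecurrentCurveFreeCompanionNonLineMixedTowers_of_g39
    (hF : NoWildOccultDivisorialThreefoldNonLineRecurrentCompanionCurveFreeBirthRecurrentCofactorBirthFreeMixedTowers)
    (h : NoWildOccultCofactorBirthRecurrentCurveFreeCompanionNonLineMixedTowers) : NoWildOccultBirthRecurrentCurveFreeCompanionNonLineMixedTowers :=
  noWildOccultBirthRecurrentCurveFreeCompanionNonLineMixedTowers_iff_g39.mpr ⟨hF, h⟩

/-- **THE RESIDUAL LETTERS UNFOLDED BY MECHANISM (kernel)**: in a tower of CELL C₃♮ʳᶠ♯ᵏ♯ with a base, the COFACTOR of every principal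
factor of weight `≥ 2` (positive coweight) at every stage has exceptional near-branches born at ARBITRARILY LATE steps — and (Law D)
never at a point where the companion chain is born. [folklore] -/
theorem doublyRecurrent_frequently_coBornAt (T : ForcedTower) (g : T.St 0 ⟶ Spec (.of k))
    (hB : IsBase (T.St 0) g) {n : ℕ} (hD : IsDatum n (T.D 0)) (hrec : ¬ BirthFreeCofactorTower T) {m a b : ℕ}
    {H K : (T.St m).IdealSheafData} (hF : FactorAt T m a b H K) (ha : 2 ≤ a) (hP : (stalkIdeal H (T.pt m)).IsPrincipal)
    (hb : 1 ≤ b) : ∀ j₀, ∃ j, j₀ ≤ j ∧ BornAt T m b K j ∧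
      Disjoint (bornSet T (m + j) b (facIter T m b K (j + 1))) (bornSet T (m + j) a (facIter T m a H (j + 1))) := by
  intro j₀
  obtain ⟨j, hj⟩ := (not_birthFreeCofactorTower_iff T).mp hrec (m + j₀) a b (facIter T m a H j₀) (facIter T m b K j₀)
    (hF.forcing T g hB hD j₀) ha (hF.principal_facIter T g hB hD hP j₀).1 hb
  exact ⟨j₀ + j, Nat.le_add_right j₀ j, (bornAt_add_iff T m b K j₀ j).mp hj,
    bornSet_disjoint_bornSet_of_factorAt T g hB hD hF.symm (j₀ + j)⟩

end CofactorCells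

end Summit.ResolutionOfSingularities.ResolutionOfSingularities.Theorems.HugValuationCut
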